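import Mathlib
import HarnessLib
import Literature.NumberTheory.DiophantineGeometry.BelyiWitnessExtremal

/-!
# Crux `CompactBalanceTransfer` (stmt-ABC-1725) — the correspondence toll, sharp form (the point at infinity)

Companion of `Negative/CorrespondenceToll.lean` (line lead `prover-line-stmt-ABC-1725-c5-0`, line `birth`,
2026-08-17).  There the Mason–Stothers count `#(zeros of p·q·(p−q)) ≥ d + 1` gave the toll `D ≥ d − 1` on the
expensive zeros `D := #(zeros ∖ {0,1})` of a degree-`d` correspondence `β = p/q` of `ℙ¹ ∖ {0,1,∞}` and showed that
the tight case `D = d − 1` forces the two finite cusps `0, 1` into the fibre `β⁻¹{0,1,∞}`.  The fibre also contains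
the point `∞` exactly when one of `deg p, deg q, deg (p − q)` drops below `d`, and Riemann–Hurwitz says
`#β⁻¹{0,1,∞} ≥ d + 2` — one more than Mason–Stothers sees when no degree drops.  This file proves that sharper
count from Mason–Stothers itself by a Möbius change of variable (`x = α + 1/y` moves a zero `α` to `∞`):

* `add_two_le_card_roots_of_natDegree_eq` : if `deg p = deg q = deg (p − q) = d ≥ 1` (no drop: `∞ ∉` fibre) then
  `p·q·(p−q)` has at least `d + 2` distinct zeros;
* `fibre_count` : in general `d + 2 ≤ D + [0 ∈ fibre] + [1 ∈ fibre] + [∞ ∈ fibre]` (Riemann–Hurwitz for the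
  three-point fibre, counting form);
* `cusps_mem_fibre_of_tight` : the complete statement of Lemma NA / O1 of the crux record
  (`Cruxes/CompactBalanceTransfer/Obstructions-r1-k2.md` §2: "a degree-d ℚ-correspondence with rad-control must
  have `{0,1,∞} ⊂ β⁻¹{0,1,∞}` (junk degree exactly `d − 1`)"): `D + 1 ≤ d` forces `0`, `1` AND `∞` into the fibre
  and `D + 1 = d`.

Reading for the crux (as in the companion file): an identity that transfers abc-quality (`D ≤ d − 1`, the only case
in which the transferred exponent beats a counterexample exponent, `Negative.toll_bites`) is ramified-cusp-preserving
at all three cusps, so it maps deep triples to deep triples and the compactly balanced cell is never reached from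
the deep cells by bounded-degree algebra.  No `def`s; unconditional; axioms standard.
-/

-- `Summit.<Summit>.<Problem>`: for the single-conjunct summit `ABC` the duplicate `ABC.ABC` is mandated.
set_option linter.dupNamespace false

namespace Summit.ABC.ABC.Theorems.CompactBalanceTransfer.Negative

open Polynomial
open Literature.NumberTheory.DiophantineGeometry

variable {k : Type*} [Field k] [IsAlgClosed k] [CharZero k] [DecidableEq k]

/-- Coprime polynomials have no common zero (Bézout evaluated at the point). [folklore] -/
theorem eval_ne_zero_or_of_isCoprime {R : Type*} [CommRing R] [Nontrivial R] {p q : R[X]}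
    (h : IsCoprime p q) (a : R) : p.eval a ≠ 0 ∨ q.eval a ≠ 0 := by
  obtain ⟨u, v, huv⟩ := h
  rcases ne_or_eq (p.eval a) 0 with hp | hp
  · exact Or.inl hp
  rcases ne_or_eq (q.eval a) 0 with hq | hq
  · exact Or.inr hq
  have := congrArg (eval a) huv
  simp only [eval_add, eval_mul, hp, hq, mul_zero, add_zero, eval_one] at this
  exact absurd this zero_ne_one

omit [IsAlgClosed k] [CharZero k] [DecidableEq k] in
/-- A zero `γ ≠ 0` of the reflection `reflect d g` (`deg g ≤ d`) is the inverse of a zero of `g`. [folklore] -/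
theorem eval_inv_eq_zero_of_eval_reflect {g : k[X]} {d : ℕ} (hg : g.natDegree ≤ d) {γ : k} (hγ : γ ≠ 0)
    (h : (reflect d g).eval γ = 0) : g.eval γ⁻¹ = 0 := by
  haveI : Invertible (γ⁻¹ : k) := invertibleOfNonzero (inv_ne_zero hγ)
  have hinv : ⅟(γ⁻¹ : k) = γ := by rw [invOf_eq_inv, inv_inv]
  have key := eval₂_reflect_eq_zero_iff (RingHom.id k) (γ⁻¹ : k) d g hg
  rw [hinv] at key
  exact key.mp h

/-- **Riemann–Hurwitz count, no-drop case (from Mason–Stothers by a Möbius change of variable).**  For coprime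
`p, q ∈ k[X]` (`k` algebraically closed of characteristic `0`) with `deg p = deg q = deg (p − q) = d ≥ 1` — so that
`∞` is NOT in the fibre of `p/q` over `{0, 1, ∞}` — the product `p · q · (p − q)` has at least `d + 2` distinct zeros.
Proof: move a zero `α` to infinity by `x = α + 1/y`; the new pair `(y^d p(α + 1/y), y^d q(α + 1/y))` is coprime of
degree `d`, Mason–Stothers gives it `d + 1` zeros, all non-zero, and `y ↦ α + 1/y` injects them into the zeros of
`p·q·(p−q)` other than `α`. [folklore] -/
theorem add_two_le_card_roots_of_natDegree_eq {p q : k[X]} (hcop : IsCoprime p q) {d : ℕ} (hd : 0 < d)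
    (hp : p.natDegree = d) (hq : q.natDegree = d) (hpq : (p - q).natDegree = d) :
    d + 2 ≤ (p * q * (p - q)).roots.toFinset.card := by
  have hmax : max p.natDegree q.natDegree = d := by rw [hp, hq, max_self]
  have hN := succ_max_natDegree_le_card_roots hcop hmax hd
  have hf0 : p * q * (p - q) ≠ 0 := by
    intro h
    rw [h, roots_zero, Multiset.toFinset_zero, Finset.card_empty] at hN
    omega
  -- a zero `α` of `p q (p - q)`
  obtain ⟨α, hα⟩ : (p * q * (p - q)).roots.toFinset.Nonempty := Finset.card_pos.mp (by omega)
  -- translate: `T = X + α`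
  set T : k[X] := X + C α with hT
  have hT1 : T.natDegree = 1 := natDegree_X_add_C α
  have hev : ∀ (g : k[X]) (x : k), (g.comp T).eval x = g.eval (x + α) := fun g x => by
    rw [eval_comp, hT, eval_add, eval_X, eval_C]
  have hdegT : ∀ g : k[X], (g.comp T).natDegree = g.natDegree := fun g => by
    rw [natDegree_comp, hT1, mul_one]
  set p₁ : k[X] := p.comp T with hp₁_def
  set q₁ : k[X] := q.comp T with hq₁_def
  have hp₁ : p₁.natDegree = d := by rw [hp₁_def, hdegT, hp]
  have hq₁ : q₁.natDegree = d := by rw [hq₁_def, hdegT, hq]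
  have hpq₁' : p₁ - q₁ = (p - q).comp T := by rw [hp₁_def, hq₁_def, sub_comp]
  have hpq₁ : (p₁ - q₁).natDegree = d := by rw [hpq₁', hdegT, hpq]
  have hcop₁ : IsCoprime p₁ q₁ := by
    have := hcop.map (compRingHom T)
    simpa only [coe_compRingHom_apply] using this
  -- reflect at degree `d`: `y ↦ 1/y`
  set p₂ : k[X] := reflect d p₁ with hp₂_def
  set q₂ : k[X] := reflect d q₁ with hq₂_def
  have hsub₂ : p₂ - q₂ = reflect d (p₁ - q₁) := by rw [hp₂_def, hq₂_def, reflect_sub]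
  -- constant terms of the reflections are leading coefficients, hence non-zero
  have hc0 : ∀ g : k[X], g.natDegree = d → (reflect d g).eval 0 ≠ 0 := by
    intro g hg
    have hg0 : g ≠ 0 := by rintro rfl; rw [natDegree_zero] at hg; omega
    rw [← coeff_zero_eq_eval_zero, coeff_reflect, revAt_zero, ← hg]
    exact leadingCoeff_ne_zero.mpr hg0
  have hdeg₂ : ∀ g : k[X], g.natDegree = d → (reflect d g).natDegree ≤ d := fun g hg =>
    natDegree_reflect_le.trans (by rw [hg, max_self])
  have hcoeff_d : ∀ g : k[X], (reflect d g).coeff d = g.eval 0 := fun g => by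
    rw [coeff_reflect, revAt_le le_rfl, Nat.sub_self, coeff_zero_eq_eval_zero]
  -- `max (deg p₂) (deg q₂) = d`: the one of `p₁, q₁` not vanishing at `0` keeps degree `d`
  have hmax₂ : max p₂.natDegree q₂.natDegree = d := by
    rcases eval_ne_zero_or_of_isCoprime hcop₁ 0 with h | h
    · have h' : p₂.coeff d ≠ 0 := by rwa [hp₂_def, hcoeff_d]
      have : p₂.natDegree = d := le_antisymm (hdeg₂ p₁ hp₁) (le_natDegree_of_ne_zero h')
      rw [this, max_eq_left (hdeg₂ q₁ hq₁)]
    · have h' : q₂.coeff d ≠ 0 := by rwa [hq₂_def, hcoeff_d]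
      have : q₂.natDegree = d := le_antisymm (hdeg₂ q₁ hq₁) (le_natDegree_of_ne_zero h')
      rw [this, max_eq_right (hdeg₂ p₁ hp₁)]
  -- `p₂, q₂` coprime: a common zero `γ` is non-zero and `γ⁻¹` would be a common zero of `p₁, q₁`
  have hcop₂ : IsCoprime p₂ q₂ := by
    rw [Polynomial.isCoprime_iff_aeval_ne_zero_of_isAlgClosed k k p₂ q₂]
    intro γ
    rw [coe_aeval_eq_eval]
    by_cases hγ : γ = 0
    · left
      rw [hγ]
      exact hc0 p₁ hp₁
    · rcases ne_or_eq (p₂.eval γ) 0 with hpγ | hpγ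
      · exact Or.inl hpγ
      rcases ne_or_eq (q₂.eval γ) 0 with hqγ | hqγ
      · exact Or.inr hqγ
      have h₁ := eval_inv_eq_zero_of_eval_reflect hp₁.le hγ hpγ
      have h₂ := eval_inv_eq_zero_of_eval_reflect hq₁.le hγ hqγ
      rcases eval_ne_zero_or_of_isCoprime hcop₁ γ⁻¹ with h | h
      · exact absurd h₁ h
      · exact absurd h₂ h
  -- Mason–Stothers for the reflected pair
  have hN₂ := succ_max_natDegree_le_card_roots hcop₂ hmax₂ hd
  have hf₂0 : p₂ * q₂ * (p₂ - q₂) ≠ 0 := by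
    intro h
    rw [h, roots_zero, Multiset.toFinset_zero, Finset.card_empty] at hN₂
    omega
  -- every zero `γ` of the reflected product is non-zero and `γ⁻¹ + α` is a zero of `p q (p - q)`
  have hroot : ∀ γ ∈ (p₂ * q₂ * (p₂ - q₂)).roots.toFinset,
      γ ≠ 0 ∧ (p * q * (p - q)).eval (γ⁻¹ + α) = 0 := by
    intro γ hγ
    rw [Multiset.mem_toFinset, mem_roots hf₂0, IsRoot, eval_mul, eval_mul, hsub₂] at hγ
    have hγ0 : γ ≠ 0 := by
      rintro rfl
      rcases mul_eq_zero.mp hγ with h | h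
      · rcases mul_eq_zero.mp h with h | h
        · exact hc0 p₁ hp₁ h
        · exact hc0 q₁ hq₁ h
      · exact hc0 _ hpq₁ h
    refine ⟨hγ0, ?_⟩
    have hfac : (p * q * (p - q)).eval (γ⁻¹ + α) =
        p₁.eval γ⁻¹ * q₁.eval γ⁻¹ * (p₁ - q₁).eval γ⁻¹ := by
      rw [hpq₁', hp₁_def, hq₁_def, hev, hev, hev, eval_mul, eval_mul, eval_sub]
    rw [hfac]
    rcases mul_eq_zero.mp hγ with h | h
    · rcases mul_eq_zero.mp h with h | h
      · rw [eval_inv_eq_zero_of_eval_reflect hp₁.le hγ0 h, zero_mul, zero_mul]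
      · rw [eval_inv_eq_zero_of_eval_reflect hq₁.le hγ0 h, mul_zero, zero_mul]
    · rw [eval_inv_eq_zero_of_eval_reflect hpq₁.le hγ0 h, mul_zero]
  -- inject the zeros of the reflected product into the zeros of `p q (p - q)` other than `α`
  have hmaps : Set.MapsTo (fun γ : k => γ⁻¹ + α) ↑(p₂ * q₂ * (p₂ - q₂)).roots.toFinset
      ↑((p * q * (p - q)).roots.toFinset.erase α) := by
    intro γ hγ
    obtain ⟨hγ0, hev0⟩ := hroot γ hγ
    rw [Finset.mem_coe, Finset.mem_erase]
    refine ⟨?_, ?_⟩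
    · intro h
      exact inv_ne_zero hγ0 (add_eq_right.mp h)
    · rw [Multiset.mem_toFinset, mem_roots hf0]
      exact hev0
  have hinj : Set.InjOn (fun γ : k => γ⁻¹ + α) ↑(p₂ * q₂ * (p₂ - q₂)).roots.toFinset := by
    intro x _ y _ hxy
    exact inv_injective (add_right_cancel hxy)
  have hcard := Finset.card_le_card_of_injOn _ hmaps hinj
  rw [Finset.card_erase_of_mem hα] at hcard
  omega

/-- **Riemann–Hurwitz for the three-point fibre (counting form).** For coprime `p, q` with
`max (deg p) (deg q) = d ≥ 1`, writing `D` for the zeros of `p·q·(p−q)` other than `0, 1`: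
`d + 2 ≤ D + [0 ∈ fibre] + [1 ∈ fibre] + [∞ ∈ fibre]`, where `∞ ∈ fibre` means that one of
`deg p, deg q, deg (p − q)` drops below `d`. [folklore] -/
theorem fibre_count {p q : k[X]} (hcop : IsCoprime p q) {d : ℕ}
    (hmax : max p.natDegree q.natDegree = d) (hd : 0 < d) :
    d + 2 ≤ ((p * q * (p - q)).roots.toFinset \ {0, 1}).card
      + (if (p * q * (p - q)).eval 0 = 0 then 1 else 0)
      + (if (p * q * (p - q)).eval 1 = 0 then 1 else 0)
      + (if p.natDegree < d ∨ q.natDegree < d ∨ (p - q).natDegree < d then 1 else 0) := by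
  have hN := succ_max_natDegree_le_card_roots hcop hmax hd
  have hf0 : p * q * (p - q) ≠ 0 := by
    intro h
    rw [h, roots_zero, Multiset.toFinset_zero, Finset.card_empty] at hN
    omega
  have hsplit := Finset.card_sdiff_add_card_inter (p * q * (p - q)).roots.toFinset {0, 1}
  -- the cusp part of the affine fibre, counted exactly
  have hinter : ((p * q * (p - q)).roots.toFinset ∩ {0, 1}).card =
      (if (p * q * (p - q)).eval 0 = 0 then 1 else 0)
        + (if (p * q * (p - q)).eval 1 = 0 then 1 else 0) := by
    have hmem : ∀ x : k, x ∈ (p * q * (p - q)).roots.toFinset ↔ (p * q * (p - q)).eval x = 0 :=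
      fun x => by rw [Multiset.mem_toFinset, mem_roots hf0, IsRoot]
    rw [Finset.inter_comm]
    by_cases h0 : (p * q * (p - q)).eval 0 = 0 <;> by_cases h1 : (p * q * (p - q)).eval 1 = 0
    · rw [Finset.insert_inter_of_mem ((hmem 0).mpr h0), Finset.singleton_inter_of_mem ((hmem 1).mpr h1),
        if_pos h0, if_pos h1, Finset.card_pair (zero_ne_one' k)]
    · rw [Finset.insert_inter_of_mem ((hmem 0).mpr h0),
        Finset.singleton_inter_of_notMem (fun h => h1 ((hmem 1).mp h)), if_pos h0, if_neg h1,
        Finset.insert_empty, Finset.card_singleton]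
    · rw [Finset.insert_inter_of_notMem (fun h => h0 ((hmem 0).mp h)),
        Finset.singleton_inter_of_mem ((hmem 1).mpr h1), if_neg h0, if_pos h1, Finset.card_singleton]
    · rw [Finset.insert_inter_of_notMem (fun h => h0 ((hmem 0).mp h)),
        Finset.singleton_inter_of_notMem (fun h => h1 ((hmem 1).mp h)), if_neg h0, if_neg h1,
        Finset.card_empty]
  by_cases hdrop : p.natDegree < d ∨ q.natDegree < d ∨ (p - q).natDegree < d
  · rw [if_pos hdrop]
    omega
  · rw [if_neg hdrop]
    simp only [not_or, not_lt] at hdrop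
    obtain ⟨hp, hq, hpq⟩ := hdrop
    have hp' : p.natDegree = d := le_antisymm (hmax ▸ le_max_left _ _) hp
    have hq' : q.natDegree = d := le_antisymm (hmax ▸ le_max_right _ _) hq
    have hpq' : (p - q).natDegree = d :=
      le_antisymm ((natDegree_sub_le p q).trans hmax.le) hpq
    have hRH := add_two_le_card_roots_of_natDegree_eq hcop hd hp' hq' hpq'
    omega

/-- **Lemma NA / O1, complete statement: tight correspondences contain all three cusps in their fibre.**
If the expensive count is as small as Mason–Stothers allows, `D + 1 ≤ d`, then `p·q·(p−q)` vanishes at `0` and at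
`1` AND one of `deg p, deg q, deg (p − q)` drops below `d` (`∞` in the fibre), and `D + 1 = d` exactly: the junk
of a quality-transferring degree-`d` correspondence has degree exactly `d − 1` and the correspondence is
cusp-preserving at `0, 1, ∞` — deep triples go to deep triples. [folklore] -/
theorem cusps_mem_fibre_of_tight {p q : k[X]} (hcop : IsCoprime p q) {d : ℕ}
    (hmax : max p.natDegree q.natDegree = d) (hd : 0 < d)
    (htight : ((p * q * (p - q)).roots.toFinset \ {0, 1}).card + 1 ≤ d) :
    (p * q * (p - q)).eval 0 = 0 ∧ (p * q * (p - q)).eval 1 = 0 ∧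
      (p.natDegree < d ∨ q.natDegree < d ∨ (p - q).natDegree < d) ∧
      ((p * q * (p - q)).roots.toFinset \ {0, 1}).card + 1 = d := by
  have h := fibre_count hcop hmax hd
  -- each indicator is at most `1`, and `D + 1 ≤ d`; so all three indicators are `1` and `D + 1 = d`
  have hI1 : (if (p * q * (p - q)).eval 1 = 0 then 1 else 0) ≤ 1 := by split <;> omega
  have hI2 : (if p.natDegree < d ∨ q.natDegree < d ∨ (p - q).natDegree < d then 1 else 0) ≤ 1 := by
    split <;> omega
  have h0 : (p * q * (p - q)).eval 0 = 0 := by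
    by_contra h0
    rw [if_neg h0] at h
    omega
  rw [if_pos h0] at h
  have h1 : (p * q * (p - q)).eval 1 = 0 := by
    by_contra h1
    rw [if_neg h1] at h
    omega
  rw [if_pos h1] at h
  have hdrop : p.natDegree < d ∨ q.natDegree < d ∨ (p - q).natDegree < d := by
    by_contra hdrop
    rw [if_neg hdrop] at h
    omega
  rw [if_pos hdrop] at h
  exact ⟨h0, h1, hdrop, by omega⟩

/-- **Balanced at one deep end costs a full degree, and then some.** Sharp form of
`Negative.correspondence_toll_of_balanced_at_zero`: if `(p·q·(p−q))(0) ≠ 0` then `d ≤ D`, and `d + 1 ≤ D` unless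
`1` and `∞` are both in the fibre. [folklore] -/
theorem correspondence_toll_of_balanced_at_zero_sharp {p q : k[X]} (hcop : IsCoprime p q) {d : ℕ}
    (hmax : max p.natDegree q.natDegree = d) (hd : 0 < d)
    (h0 : (p * q * (p - q)).eval 0 ≠ 0) :
    d ≤ ((p * q * (p - q)).roots.toFinset \ {0, 1}).card ∧
      (((p * q * (p - q)).eval 1 ≠ 0 ∨ ¬ (p.natDegree < d ∨ q.natDegree < d ∨ (p - q).natDegree < d)) →
        d + 1 ≤ ((p * q * (p - q)).roots.toFinset \ {0, 1}).card) := by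
  have h := fibre_count hcop hmax hd
  rw [if_neg h0, add_zero] at h
  have hI1 : (if (p * q * (p - q)).eval 1 = 0 then 1 else 0) ≤ 1 := by split <;> omega
  have hI2 : (if p.natDegree < d ∨ q.natDegree < d ∨ (p - q).natDegree < d then 1 else 0) ≤ 1 := by
    split <;> omega
  refine ⟨by omega, ?_⟩
  rintro (h1 | hdrop)
  · rw [if_neg h1, add_zero] at h
    omega
  · rw [if_neg hdrop, add_zero] at h
    omega

end Summit.ABC.ABC.Theorems.CompactBalanceTransfer.Negative
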